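import Mathlib
import Literature.AlgebraicGeometry.Resolution.QuasiExcellentCurveDelta
import Literature.AlgebraicGeometry.Resolution.QuasiExcellentBlowup
import Literature.AlgebraicGeometry.Resolution.StalkIdealLemmas
import Literature.AlgebraicGeometry.Resolution.BlowupsIntegral
import HarnessLib

/-!
# `δ` of the strict transform of a curve under the blowing up of a point

Topic: `Literature/AlgebraicGeometry/Resolution`. The `δ`-drop theorem in the form consumed by the
termination of steps 1–2 of Cossart–Piltant's algorithm ([CoP1] Prop. 4.4, p. 10: "let `x ∈ Σ(i)`
be a singular point of some irreducible component of `Σ(i)` of dimension one. Take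
`X(i+1) := Bl_x X(i)` … By embedded resolution of curves, we have `s(i) ≥ 2` for `i >> 0`"): for a
closed immersion `i : C ↪ X` of an integral Noetherian quasi-excellent scheme `C` of dimension
`≤ 1` (a curve on the stage `X`), a closed point `x = i(c)` of `X` at which `C` is singular, and
the blowing up `ρ : C' → C` of `C` along the inverse image `i⁻¹𝓘_{{x}} · 𝒪_C` of the ideal of
the reduced point — the STRICT TRANSFORM of `C` in `Bl_x X` (`BlowupStrictTransform.lean`:
`C' ↪ Bl_x X` is a closed immersion) — the total `δ`-invariant drops: **`δ(C') < δ(C)`**, and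
`C'` is again an integral quasi-excellent curve with finite `δ`-support
(`IsBlowup.finsum_pointDelta_strictTransform_lt`). All hypotheses of the abstract theorems
(`CurveBlowupDeltaDrop.lean`, `QuasiExcellentCurveDelta.lean`) are discharged here:

* `support_comap_vanishingIdeal_singleton`, `stalkIdeal_comap_vanishingIdeal_singleton` — the
  centre `i⁻¹𝓘_{{x}} 𝒪_C` has support `{c}` and stalk `𝔪_{C,c}`;
* `comap_vanishingIdeal_singleton_ne_bot` — it is non-zero when `dim 𝒪_{C,c} = 1`;
* `IsBlowup.isIntegral_strictTransform`, `IsBlowup.isQuasiExcellent_strictTransform`,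
  `IsBlowup.topologicalKrullDim_strictTransform_le` — `C'` is an integral quasi-excellent curve.

## Sources

* V. Cossart, O. Piltant, J. Algebra 320 (2008), proof of Prop. 4.4, p. 10. [CossartPiltant2008]
* J. Kollár, *Lectures on Resolution of Singularities* (2007), §1.4. [Kollar2007]
-/

noncomputable section

open CategoryTheory AlgebraicGeometry TopologicalSpace IsLocalRing

namespace Literature.AlgebraicGeometry.Resolution

universe u

open Scheme.IdealSheafData

variable {X C : Scheme.{u}} (i : C ⟶ X) [IsClosedImmersion i] {x : X} (hx : IsClosed ({x} : Set X))
  {c : C} (hc : i c = x)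

/-! ## The centre `i⁻¹𝓘_{{x}} 𝒪_C` -/

include hc in
/-- `i⁻¹({x}) = {c}` for the closed immersion `i`. [folklore] -/
theorem preimage_singleton_eq_of_isClosedImmersion : i ⁻¹' {x} = {c} := by
  ext c'
  simp only [Set.mem_preimage, Set.mem_singleton_iff]
  constructor
  · intro h
    exact i.isClosedEmbedding.injective (h.trans hc.symm)
  · rintro rfl; exact hc

include hc in
/-- The support of `i⁻¹𝓘_{{x}} 𝒪_C` is `{c}`. [folklore] -/
theorem support_comap_vanishingIdeal_singleton :
    (((vanishingIdeal ⟨{x}, hx⟩).comap i).support : Set C) = {c} := by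
  rw [Scheme.IdealSheafData.support_comap, Closeds.coe_preimage,
    Scheme.IdealSheafData.coe_support_vanishingIdeal]
  exact preimage_singleton_eq_of_isClosedImmersion i hc

include hc in
/-- The stalk of `i⁻¹𝓘_{{x}} 𝒪_C` at `c` is `𝔪_{C,c}` (`𝔪_{X,x} ↠ 𝔪_{C,c}`). [folklore] -/
theorem stalkIdeal_comap_vanishingIdeal_singleton :
    stalkIdeal ((vanishingIdeal ⟨{x}, hx⟩).comap i) c = maximalIdeal (C.presheaf.stalk c) := by
  subst hc
  rw [stalkIdeal_comap_eq_map_stalkMap, stalkIdeal_vanishingIdeal_singleton]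
  exact IsLocalRing.map_maximalIdeal_of_surjective _ (i.stalkMap_surjective c)

include hc in
/-- The centre is non-zero as soon as `𝒪_{C,c}` is not a field (else its support `{c}` would be
all of `C`, and `c` the generic point). [folklore] -/
theorem comap_vanishingIdeal_singleton_ne_bot [IsIntegral C] (hcf : ¬ IsField (C.presheaf.stalk c)) :
    (vanishingIdeal ⟨{x}, hx⟩).comap i ≠ ⊥ := by
  intro h
  have hsupp := support_comap_vanishingIdeal_singleton i hx hc
  rw [h, Scheme.IdealSheafData.support_bot, Closeds.coe_top] at hsupp
  have hgen : genericPoint C = c := by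
    have : genericPoint C ∈ ({c} : Set C) := hsupp ▸ Set.mem_univ _
    simpa using this
  apply hcf
  rw [← hgen]
  exact Semifield.toIsField _

/-! ## The strict transform is an integral quasi-excellent curve -/

variable {C' : Scheme.{u}} {ρ : C' ⟶ C} (hρ : IsBlowup ρ ((vanishingIdeal ⟨{x}, hx⟩).comap i))

include hc hρ in
/-- The strict transform of an integral curve is integral. [cite: StacksProject, Tag 02ND] -/
theorem IsBlowup.isIntegral_strictTransform [IsIntegral C] (hcf : ¬ IsField (C.presheaf.stalk c)) :
    IsIntegral C' :=
  hρ.isIntegral (comap_vanishingIdeal_singleton_ne_bot i hx hc hcf)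

omit [IsClosedImmersion i] in
include hρ in
/-- The strict transform of a quasi-excellent locally Noetherian curve is quasi-excellent and
locally Noetherian (Stacks 07QU). [cite: StacksProject, Tag 07QU] -/
theorem IsBlowup.isLocallyNoetherian_and_isQuasiExcellent_strictTransform [IsLocallyNoetherian C]
    (hC : Scheme.IsQuasiExcellent C) : IsLocallyNoetherian C' ∧ Scheme.IsQuasiExcellent C' := by
  haveI : IsProper ρ := hρ.isProper
  haveI : IsLocallyNoetherian C' := LocallyOfFiniteType.isLocallyNoetherian ρ
  exact ⟨inferInstance, hρ.isQuasiExcellent hC⟩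

/-! ## `δ(C') < δ(C)` -/

include hc hρ in
/-- **`δ` drops under the strict transform of a curve at a singular point** (Cossart–Piltant
2008, proof of Prop. 4.4, p. 10, "by embedded resolution of curves"; Kollár 2007, §1.4): for the
blowing up `ρ : C' → C` of the integral Noetherian quasi-excellent curve `C` along
`i⁻¹𝓘_{{x}} 𝒪_C`, `x = i(c)` a singular point of `C`, the strict transform `C'` is an integral
quasi-excellent curve, its `δ`-support is finite, and `Σ_{y'} δ(𝒪_{C',y'}) < Σ_y δ(𝒪_{C,y})`.
[cite: CossartPiltant2008, proof of Prop. 4.4, p. 10] [cite: Kollar2007, §1.4] -/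
theorem IsBlowup.finsum_pointDelta_strictTransform_lt [IsIntegral C] [IsNoetherian C]
    (hC : Scheme.IsQuasiExcellent C) (hdim : topologicalKrullDim C ≤ 1)
    (h1 : ringKrullDim (C.presheaf.stalk c) = 1)
    (hsing : ¬ IsDiscreteValuationRing (C.presheaf.stalk c)) :
    haveI := hρ.isIntegral (comap_vanishingIdeal_singleton_ne_bot i hx hc
      (ringKrullDim_eq_one_iff_of_isLocalRing_isDomain.mp h1).1)
    (Function.support (pointDelta C')).Finite ∧
      ∑ᶠ y' : C', pointDelta C' y' < ∑ᶠ y : C, pointDelta C y := by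
  have hcf : ¬ IsField (C.presheaf.stalk c) :=
    (ringKrullDim_eq_one_iff_of_isLocalRing_isDomain.mp h1).1
  haveI := hρ.isIntegral (comap_vanishingIdeal_singleton_ne_bot i hx hc hcf)
  haveI : IsProper ρ := hρ.isProper
  obtain ⟨hN', hC'⟩ := hρ.isLocallyNoetherian_and_isQuasiExcellent_strictTransform i hx hC
  haveI := hN'
  have hdim' : topologicalKrullDim C' ≤ 1 := hρ.topologicalKrullDim_le hdim
  haveI := module_finite_integralClosure_stalk hC hdim c
  have hs := support_comap_vanishingIdeal_singleton i hx hc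
  have hJc := stalkIdeal_comap_vanishingIdeal_singleton i hx hc
  have hfin : ∀ c' : C', ρ c' = c → Module.Finite (C'.presheaf.stalk c')
      (integralClosure (C'.presheaf.stalk c') C'.functionField) :=
    fun c' _ => module_finite_integralClosure_stalk hC' hdim' c'
  have hsuppC := _root_.Literature.AlgebraicGeometry.Resolution.finite_support_pointDelta hC hdim
  exact ⟨hρ.finite_support_pointDelta hs hJc h1 hfin hsuppC,
    hρ.finsum_pointDelta_lt hs hJc h1 hfin hsuppC (pointDelta_ne_top hC hdim) hsing⟩

end Literature.AlgebraicGeometry.Resolution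

end
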